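import Summits.BirchSwinnertonDyer.Rank1Residual.Additive.PadicBallSeriesEval
import Mathlib.Analysis.SpecificLimits.Normed
import HarnessLib

/-!
# Evaluation of a NON-integral outer series at the value of an integral inner one:
# `∑ₙ aₙ g(t)ⁿ = ∑ₘ (f ∘ g)ₘ tᵐ` for `f = ∑ aₙXⁿ ∈ ℚ_p⟦X⟧` with `‖aₙ‖ ≤ n`, `g ∈ Xℤ_p⟦X⟧`, `‖t‖ < 1`
# in a complete ultrametric normed `ℚ_p`-algebra (cell `b2b-bsdres`, CLASS-CLOSURE lane, class O10 —
# x1b GEN 33, class lead; file 25 of the local series: the "Fubini" step behind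
# `log_E([n](z(P))) = n·log_E(z(P))` and `log_E(i(x)) = log_{F_ss}(x)` at `ℚ̄_p`-points)

HONEST FRAMING (cell `b2b-bsdres`, run/shared/lean/b2b/bsd-rank1-residual/, verbatim in every
file): the goal of the cell is to DELETE the COMBINATION-SHAPED residual classes of the
Birch–Swinnerton-Dyer formula for ALL analytic-rank `≤ 1` elliptic curves over `ℚ` — "full BSD
formula for every rank `≤ 1` curve in class `C`" assembled STRICTLY from published theorems — so
that the rank-`≤ 1` remainder becomes exactly the CONSTRUCTION-SHAPED classes, which are TYPED
(missing-input `Prop`s), NOT attempted. This is not "finishing BSD". CLASS-CLOSURE lane: prove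
what is provable now; shrink each hard class to its core with data; no claim beyond stated classes;
research routes on CONSTRUCTION-SHAPED X12 / O10; census / instrument output = EVIDENCE / conjecture
items, NEVER a Literature fact; `RESIDUAL-MAP.md` marks change only by signed lines. THIS FILE:
TOOL DEFINITION + THEOREMS (one definition with body: `qEval`, the sum `∑ₙ φ(fₙ) uⁿ ∈ K` of a
`ℚ_p`-series with `‖fₙ‖ ≤ n` at `‖u‖ < 1`; every statement proved) — no named Literature fact, no
Summits-side fact `def … : Prop`, no `sorry`, axioms standard; nothing is booked; no label / mark /
count / sub-cell moves; O10 stays OPEN / CONSTRUCTION-SHAPED; nothing about `BSD(W, p)` of any pair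
is claimed.

## Content (`K` complete ultrametric normed `ℚ_p`-algebra and field, `𝒪 = unitBall K`)

* §1 `qEval K f u = ∑' n, φ(fₙ) uⁿ` for `f ∈ ℚ_p⟦X⟧` with the LOGARITHMIC GROWTH bound `‖fₙ‖ ≤ n`
  (satisfied by `log_E`, AEC IV.6.3(a)): summability for `‖u‖ < 1` (`summable_qEval`, majorant
  `n rⁿ`), `hasSum_qEval`, the bound `‖qEval f u‖ ≤ sup n‖u‖ⁿ`-type estimates (`norm_qEval_sub_le`:
  `‖qEval f u − φ(f₁)u‖ ≤ C ‖u‖²` on `‖u‖ ≤ ρ < 1`).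
* §2 the coefficients of `f ∘ G` (`G ∈ Xℚ_p⟦X⟧`) as finite sums and their bound `‖(f ∘ G)ₘ‖ ≤ m` for
  `G` integral (`coeff_subst_eq_sum`, `norm_coeff_subst_le`).
* §3 **`qEval_subst`: `qEval (f ∘ ḡ) t = qEval f (ev₁ g t)`** for `g ∈ Xℤ_p⟦X⟧` (`ḡ = g ⊗ ℚ_p`),
  `‖t‖ < 1` — proved by truncating `f` (for a polynomial truncation the identity is the ring
  homomorphism property of `ev₁`, and the two tails are `≤ sup_{m ≥ N} m‖t‖ᵐ → 0`).

References: [SilvermanAEC2009] IV.6.3(a), IV.6.4(a) (the rearrangement in "log is a homomorphism");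
N. Bourbaki, *Algèbre* IV §4 no. 3.
-/

noncomputable section

open scoped Classical Topology
open Filter PowerSeries

namespace Summit.BirchSwinnertonDyer.Rank1Residual.Additive

namespace BallEval

open Literature.NumberTheory.GaloisRepresentations.LubinTate (unitBall mem_unitBall_iff)

variable (p : ℕ) [hp : Fact p.Prime] (K : Type*) [NontriviallyNormedField K] [NormedAlgebra ℚ_[p] K]
  [IsUltrametricDist K] [CompleteSpace K]

/-! ## §1 `qEval`: sums of `ℚ_p`-series with logarithmic growth -/

/-- **`qEval K f u = ∑ₙ φ(fₙ) uⁿ`**, the value at `u ∈ K` of a one-variable `ℚ_p`-series (meant for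
`‖fₙ‖ ≤ n` and `‖u‖ < 1`, where the series converges). [cite: SilvermanAEC2009, IV.6.3] -/
def qEval (f : ℚ_[p]⟦X⟧) (u : K) : K := ∑' n : ℕ, algebraMap ℚ_[p] K (coeff n f) * u ^ n

variable {p K}

omit [IsUltrametricDist K] [CompleteSpace K] in
/-- The termwise bound `‖φ(fₙ)uⁿ‖ ≤ n rⁿ` for `‖fₙ‖ ≤ n`, `‖u‖ ≤ r`. [folklore] -/
theorem norm_term_le {f : ℚ_[p]⟦X⟧} (hf : ∀ n, ‖coeff n f‖ ≤ n) {u : K} {r : ℝ} (hu : ‖u‖ ≤ r) (n : ℕ) :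
    ‖algebraMap ℚ_[p] K (coeff n f) * u ^ n‖ ≤ n * r ^ n := by
  rw [norm_mul, norm_pow, norm_algebraMap_padic]
  exact mul_le_mul (hf n) (pow_le_pow_left₀ (norm_nonneg _) hu n) (pow_nonneg (norm_nonneg _) _)
    (Nat.cast_nonneg _)

omit [IsUltrametricDist K] in
/-- **Summability** of `∑ φ(fₙ)uⁿ` for `‖fₙ‖ ≤ n`, `‖u‖ < 1` (majorant `n‖u‖ⁿ`). [cite: SilvermanAEC2009, IV.6.3] -/
theorem summable_qEval {f : ℚ_[p]⟦X⟧} (hf : ∀ n, ‖coeff n f‖ ≤ n) {u : K} (hu : ‖u‖ < 1) :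
    Summable fun n : ℕ => algebraMap ℚ_[p] K (coeff n f) * u ^ n := by
  refine Summable.of_norm_bounded (g := fun n : ℕ => (n : ℝ) * ‖u‖ ^ n) ?_ (fun n => norm_term_le hf le_rfl n)
  have h := summable_pow_mul_geometric_of_norm_lt_one 1 (r := ‖u‖) (by rwa [norm_norm])
  simpa [pow_one] using h

omit [IsUltrametricDist K] in
/-- The defining sum. [folklore] -/
theorem hasSum_qEval {f : ℚ_[p]⟦X⟧} (hf : ∀ n, ‖coeff n f‖ ≤ n) {u : K} (hu : ‖u‖ < 1) :
    HasSum (fun n : ℕ => algebraMap ℚ_[p] K (coeff n f) * u ^ n) (qEval p K f u) :=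
  (summable_qEval hf hu).hasSum

omit [IsUltrametricDist K] [CompleteSpace K] in
/-- `f₀ = 0` when `‖fₙ‖ ≤ n`. [folklore] -/
theorem coeff_zero_eq_zero {f : ℚ_[p]⟦X⟧} (hf : ∀ n, ‖coeff n f‖ ≤ n) : coeff 0 f = 0 := by
  have := hf 0
  rw [Nat.cast_zero] at this
  exact norm_le_zero_iff.mp this

omit [IsUltrametricDist K] [CompleteSpace K] in
/-- `qEval f 0 = 0`. [folklore] -/
theorem qEval_zero {f : ℚ_[p]⟦X⟧} (hf : ∀ n, ‖coeff n f‖ ≤ n) : qEval p K f 0 = 0 := by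
  rw [qEval]
  refine (tsum_congr fun n => ?_).trans tsum_zero
  rcases Nat.eq_zero_or_pos n with rfl | hn
  · rw [coeff_zero_eq_zero hf, map_zero, zero_mul]
  · rw [zero_pow hn.ne', mul_zero]

/-- The partial tail bound: `‖∑_{n ≥ N} φ(fₙ)uⁿ‖ ≤ sup`-form, stated as: every term with `n ≥ N` is
`≤ B` implies the sum of those terms is `≤ B`. We use the concrete consequence
**`‖qEval f u − φ(f₁) u‖ ≤ C·‖u‖²`** for `‖u‖ ≤ ρ`, with `C = sup_n (n+2) ρⁿ`-type constant; we give
the clean version `‖qEval f u − φ(f₁)u‖ ≤ ‖u‖² · B` whenever `n ρ^{n-2} ≤ B` for all `n ≥ 2`.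
[cite: SilvermanAEC2009, IV.6.3] -/
theorem norm_qEval_sub_linear_le {f : ℚ_[p]⟦X⟧} (hf : ∀ n, ‖coeff n f‖ ≤ n) {u : K} (hu : ‖u‖ < 1)
    {ρ B : ℝ} (hρ : ‖u‖ ≤ ρ) (hB0 : 0 ≤ B) (hB : ∀ n : ℕ, 2 ≤ n → (n : ℝ) * ρ ^ (n - 2) ≤ B) :
    ‖qEval p K f u - algebraMap ℚ_[p] K (coeff 1 f) * u‖ ≤ ‖u‖ ^ 2 * B := by
  have hs := summable_qEval hf hu
  -- split off the terms `n = 0, 1`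
  have h2 : qEval p K f u - algebraMap ℚ_[p] K (coeff 1 f) * u =
      ∑' n : ℕ, algebraMap ℚ_[p] K (coeff (n + 2) f) * u ^ (n + 2) := by
    rw [qEval, ← hs.sum_add_tsum_nat_add 2, Finset.sum_range_succ, Finset.sum_range_succ,
      Finset.sum_range_zero, coeff_zero_eq_zero hf, map_zero, zero_mul, zero_add, zero_add, pow_one,
      add_sub_cancel_left]
  rw [h2]
  refine IsUltrametricDist.norm_tsum_le_of_forall_le_of_nonneg (mul_nonneg (sq_nonneg _) hB0) fun n => ?_
  rw [norm_mul, norm_pow, norm_algebraMap_padic, pow_add, mul_comm (‖u‖ ^ n), ← mul_assoc]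
  have hρ0 : 0 ≤ ρ := (norm_nonneg u).trans hρ
  calc ‖coeff (n + 2) f‖ * ‖u‖ ^ 2 * ‖u‖ ^ n ≤ ((n + 2 : ℕ) : ℝ) * ‖u‖ ^ 2 * ρ ^ n := by
        refine mul_le_mul (mul_le_mul_of_nonneg_right (hf _) (sq_nonneg _))
          (pow_le_pow_left₀ (norm_nonneg _) hρ n) (pow_nonneg (norm_nonneg _) _) ?_
        exact mul_nonneg (Nat.cast_nonneg _) (sq_nonneg _)
    _ = ‖u‖ ^ 2 * (((n + 2 : ℕ) : ℝ) * ρ ^ (n + 2 - 2)) := by rw [Nat.add_sub_cancel]; ring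
    _ ≤ ‖u‖ ^ 2 * B := mul_le_mul_of_nonneg_left (hB (n + 2) (by omega)) (sq_nonneg _)

/-! ## §2 Coefficients of `f ∘ G` -/

omit hp in
/-- `coeff m (Gⁿ) = 0` for `m < n` when `G(0) = 0`. [folklore] -/
theorem coeff_pow_eq_zero_of_lt {R : Type*} [CommRing R] {G : R⟦X⟧} (hG : constantCoeff G = 0)
    {m n : ℕ} (h : m < n) : coeff m (G ^ n) = 0 := by
  obtain ⟨H, rfl⟩ : X ∣ G := PowerSeries.X_dvd_iff.mpr hG
  rw [mul_pow, PowerSeries.coeff_X_pow_mul', if_neg (not_le.mpr h)]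

omit hp in
/-- **The coefficients of `f ∘ G` as finite sums**: `(f ∘ G)ₘ = ∑_{n ≤ m} fₙ (Gⁿ)ₘ`.
[Bourbaki, Algèbre IV §4 no. 3] [folklore] -/
theorem coeff_subst_eq_sum {R : Type*} [CommRing R] {f G : R⟦X⟧} (hG : constantCoeff G = 0) (m : ℕ) :
    coeff m (f.subst G) = ∑ n ∈ Finset.range (m + 1), coeff n f * coeff m (G ^ n) := by
  rw [PowerSeries.coeff_subst' (PowerSeries.HasSubst.of_constantCoeff_zero' hG)]
  have hsub : (Function.support fun n : ℕ => coeff n f • coeff m (G ^ n)) ⊆ ↑(Finset.range (m + 1)) := by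
    intro n hn
    rw [Function.mem_support] at hn
    simp only [Finset.coe_range, Set.mem_Iio]
    by_contra h
    exact hn (by rw [coeff_pow_eq_zero_of_lt hG (by omega), smul_zero])
  rw [finsum_eq_sum_of_support_subset _ hsub]
  simp only [smul_eq_mul]

/-- `‖(ḡⁿ)ₘ‖ ≤ 1` for `g ∈ ℤ_p⟦X⟧`, `ḡ = g ⊗ ℚ_p`. [folklore] -/
theorem norm_coeff_map_pow_le_one (g : ℤ_[p]⟦X⟧) (n m : ℕ) :
    ‖coeff m ((g.map (PadicInt.Coe.ringHom (p := p))) ^ n)‖ ≤ 1 := by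
  rw [← map_pow, PowerSeries.coeff_map]
  exact PadicInt.norm_le_one _

/-- **`‖(f ∘ ḡ)ₘ‖ ≤ m`** for `‖fₙ‖ ≤ n` and `g ∈ Xℤ_p⟦X⟧`. [cite: SilvermanAEC2009, IV.6.3] -/
theorem norm_coeff_subst_le {f : ℚ_[p]⟦X⟧} (hf : ∀ n, ‖coeff n f‖ ≤ n) {g : ℤ_[p]⟦X⟧}
    (hg : constantCoeff g = 0) (m : ℕ) :
    ‖coeff m (f.subst (g.map (PadicInt.Coe.ringHom (p := p))))‖ ≤ m := by
  have hG : constantCoeff (g.map (PadicInt.Coe.ringHom (p := p))) = 0 := by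
    rw [← PowerSeries.coeff_zero_eq_constantCoeff, PowerSeries.coeff_map, PowerSeries.coeff_zero_eq_constantCoeff,
      hg, map_zero]
  rw [coeff_subst_eq_sum hG]
  refine IsUltrametricDist.norm_sum_le_of_forall_le_of_nonneg (Nat.cast_nonneg m) fun n hn => ?_
  rw [Finset.mem_range] at hn
  rw [norm_mul]
  calc ‖coeff n f‖ * ‖coeff m ((g.map PadicInt.Coe.ringHom) ^ n)‖ ≤ n * 1 :=
        mul_le_mul (hf n) (norm_coeff_map_pow_le_one g n m) (norm_nonneg _) (Nat.cast_nonneg _)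
    _ ≤ m := by rw [mul_one]; exact_mod_cast Nat.lt_succ_iff.mp hn

/-! ## §3 `qEval (f ∘ ḡ) t = qEval f (g(t))` -/

/-- The truncations `f_N = ∑_{n<N} fₙ Xⁿ` evaluated: `∑_{n<N} φ(fₙ) g(t)ⁿ = ∑ₘ φ((f_N ∘ ḡ)ₘ) tᵐ` where
`(f_N ∘ ḡ)ₘ = ∑_{n<N, n ≤ m} fₙ(ḡⁿ)ₘ` (finite linear combination of the sums `hasSum_ev₁`). [folklore] -/
theorem hasSum_truncation {f : ℚ_[p]⟦X⟧} {g : ℤ_[p]⟦X⟧} {t : unitBall K} (ht : ‖(t : K)‖ < 1) (N : ℕ) :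
    HasSum (fun m : ℕ => algebraMap ℚ_[p] K
        (∑ n ∈ Finset.range N, coeff n f * coeff m ((g.map (PadicInt.Coe.ringHom (p := p))) ^ n)) * (t : K) ^ m)
      (∑ n ∈ Finset.range N, algebraMap ℚ_[p] K (coeff n f) *
        ((ev₁ p K t (hasEval_of_norm_lt_one ht) g : unitBall K) : K) ^ n) := by
  have h : ∀ n ∈ Finset.range N, HasSum (fun m : ℕ => algebraMap ℚ_[p] K (coeff n f) *
      (algebraMap ℚ_[p] K ((coeff m (g ^ n) : ℤ_[p]) : ℚ_[p]) * (t : K) ^ m))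
      (algebraMap ℚ_[p] K (coeff n f) * ((ev₁ p K t (hasEval_of_norm_lt_one ht) g : unitBall K) : K) ^ n) := by
    intro n _
    have := (hasSum_ev₁ (hasEval_of_norm_lt_one ht) (g ^ n)).mul_left (algebraMap ℚ_[p] K (coeff n f))
    rwa [map_pow, SubmonoidClass.coe_pow] at this
  have hs := hasSum_sum h
  refine hs.congr_fun fun m => ?_
  rw [map_sum, Finset.sum_mul]
  refine Finset.sum_congr rfl fun n _ => ?_
  rw [map_mul, ← map_pow, PowerSeries.coeff_map, mul_assoc]
  rfl

/-- **Evaluation of `f ∘ ḡ` at `t` is `f` at `g(t)`** (`‖fₙ‖ ≤ n`, `g ∈ Xℤ_p⟦X⟧`, `‖t‖ < 1`):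
`qEval (f ∘ ḡ) t = qEval f (ev₁ g t)`. Proof: truncate `f` below `N`; the truncated identity is
`hasSum_truncation`; both tails are sums of terms of norm `≤ m‖t‖ᵐ` with `m ≥ N`, hence `→ 0`.
[cite: SilvermanAEC2009, IV.6.4] -/
theorem qEval_subst {f : ℚ_[p]⟦X⟧} (hf : ∀ n, ‖coeff n f‖ ≤ n) {g : ℤ_[p]⟦X⟧} (hg : constantCoeff g = 0)
    {t : unitBall K} (ht : ‖(t : K)‖ < 1) :
    qEval p K (f.subst (g.map (PadicInt.Coe.ringHom (p := p)))) (t : K) =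
      qEval p K f ((ev₁ p K t (hasEval_of_norm_lt_one ht) g : unitBall K) : K) := by
  set u : K := ((ev₁ p K t (hasEval_of_norm_lt_one ht) g : unitBall K) : K) with hudef
  have hu : ‖u‖ < 1 := (norm_ev₁_le _ ht.le hg).trans_lt ht
  have hut : ‖u‖ ≤ ‖(t : K)‖ := norm_ev₁_le _ ht.le hg
  set F : ℚ_[p]⟦X⟧ := f.subst (g.map (PadicInt.Coe.ringHom (p := p))) with hFdef
  have hF : ∀ m, ‖coeff m F‖ ≤ m := norm_coeff_subst_le hf hg
  have hsF := summable_qEval (K := K) hF ht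
  have hsf := summable_qEval (K := K) hf hu
  -- it suffices: partial sums of `qEval f u` tend to `qEval F t`
  change qEval p K F (t : K) = ∑' n : ℕ, algebraMap ℚ_[p] K (coeff n f) * u ^ n
  refine (tendsto_nhds_unique hsf.hasSum.tendsto_sum_nat ?_).symm
  rw [Metric.tendsto_atTop]
  intro ε hε
  -- `m ‖t‖^m → 0`: beyond `N₀` all such terms are `< ε`
  have hr0 : 0 ≤ ‖(t : K)‖ := norm_nonneg _
  obtain ⟨N₀, hN₀⟩ : ∃ N₀ : ℕ, ∀ m, N₀ ≤ m → (m : ℝ) * ‖(t : K)‖ ^ m < ε / 2 := by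
    have h := tendsto_self_mul_const_pow_of_lt_one hr0 ht
    rw [Metric.tendsto_atTop] at h
    obtain ⟨N, hN⟩ := h (ε / 2) (half_pos hε)
    refine ⟨N, fun m hm => ?_⟩
    have := hN m hm
    rw [Real.dist_eq, sub_zero, abs_of_nonneg (mul_nonneg (Nat.cast_nonneg _) (pow_nonneg hr0 _))] at this
    exact this
  refine ⟨N₀, fun N hN => ?_⟩
  -- the difference `qEval F t − ∑_{n<N} φ(fₙ)uⁿ` is the sum over `m` of the `N`-tails of the coefficients
  have htr := hasSum_truncation (p := p) (K := K) (f := f) (g := g) ht N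
  have hdiff : qEval p K F (t : K) - ∑ n ∈ Finset.range N, algebraMap ℚ_[p] K (coeff n f) * u ^ n =
      ∑' m : ℕ, algebraMap ℚ_[p] K (coeff m F -
        ∑ n ∈ Finset.range N, coeff n f * coeff m ((g.map (PadicInt.Coe.ringHom (p := p))) ^ n)) *
          (t : K) ^ m := by
    rw [hudef, ← htr.tsum_eq, qEval, ← hsF.tsum_sub htr.summable]
    refine tsum_congr fun m => ?_
    rw [map_sub, sub_mul]
  rw [dist_eq_norm, ← norm_neg, neg_sub, hdiff]
  -- each term: zero for `m < N`, and `≤ m ‖t‖^m < ε/2` for `m ≥ N ≥ N₀`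
  have hG : constantCoeff (g.map (PadicInt.Coe.ringHom (p := p))) = 0 := by
    rw [← PowerSeries.coeff_zero_eq_constantCoeff, PowerSeries.coeff_map, PowerSeries.coeff_zero_eq_constantCoeff,
      hg, map_zero]
  have hterm : ∀ m : ℕ, ‖algebraMap ℚ_[p] K (coeff m F -
      ∑ n ∈ Finset.range N, coeff n f * coeff m ((g.map (PadicInt.Coe.ringHom (p := p))) ^ n)) *
        (t : K) ^ m‖ ≤ ε / 2 := by
    intro m
    by_cases hm : m < N
    · -- all of `(F)ₘ = ∑_{n ≤ m}` is captured by the truncation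
      have : coeff m F - ∑ n ∈ Finset.range N, coeff n f * coeff m ((g.map (PadicInt.Coe.ringHom (p := p))) ^ n)
          = 0 := by
        rw [hFdef, coeff_subst_eq_sum hG, sub_eq_zero]
        refine (Finset.sum_subset (Finset.range_subset_range.mpr (by omega)) fun n hn hn' => ?_)
        rw [Finset.mem_range] at hn hn'
        rw [coeff_pow_eq_zero_of_lt hG (by omega), mul_zero]
      rw [this, map_zero, zero_mul, norm_zero]; exact (half_pos hε).le
    · push Not at hm
      have hb : ‖coeff m F - ∑ n ∈ Finset.range N,
          coeff n f * coeff m ((g.map (PadicInt.Coe.ringHom (p := p))) ^ n)‖ ≤ m := by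
        rw [sub_eq_add_neg]
        refine (IsUltrametricDist.norm_add_le_max _ _).trans (max_le (hF m) ?_)
        rw [norm_neg]
        refine IsUltrametricDist.norm_sum_le_of_forall_le_of_nonneg (Nat.cast_nonneg m) fun n _ => ?_
        by_cases hnm : m < n
        · rw [coeff_pow_eq_zero_of_lt hG hnm, mul_zero, norm_zero]; exact Nat.cast_nonneg m
        · push Not at hnm
          rw [norm_mul]
          calc ‖coeff n f‖ * ‖coeff m ((g.map PadicInt.Coe.ringHom) ^ n)‖ ≤ n * 1 :=
                mul_le_mul (hf n) (norm_coeff_map_pow_le_one g n m) (norm_nonneg _) (Nat.cast_nonneg _)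
            _ ≤ m := by rw [mul_one]; exact_mod_cast hnm
      rw [norm_mul, norm_pow, norm_algebraMap_padic]
      calc _ ≤ (m : ℝ) * ‖(t : K)‖ ^ m := mul_le_mul hb le_rfl (pow_nonneg hr0 _) (Nat.cast_nonneg _)
        _ ≤ ε / 2 := (hN₀ m (hN.trans hm)).le
  calc _ ≤ ε / 2 := IsUltrametricDist.norm_tsum_le_of_forall_le_of_nonneg (half_pos hε).le hterm
    _ < ε := half_lt_self hε

end BallEval

end Summit.BirchSwinnertonDyer.Rank1Residual.Additive

end
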